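/-
Origin: expansion seat `prover-pub-hodgecm-mc-binder-2-g6-0`, handover #3 14:59Z md5 6b7b14981f04 (149 l.; imports #2 + #K165; CM pin `cmSplittingOf`, `abbrev cmArchWeilRep`, `omega_cmPairSplitting_arch_map_tmul`) (`HOME/mc/pub-hodgecm-mc-binder-2/g6/pkg/HodgeCM/Model/HypCensus/ArchDatumCM.lean`, md5 6b7b1498, 149 lines);
landed by the gen-12 packager (p-g12) in gate run 36 as `HodgeCM/Model/HypCensus/ArchDatumCM.lean` (verbatim).
-/
/-
Origin: speedrun cell pub-hodgecm, MODEL-CONSTRUCTION sub-cell, lineage mc-binder-2 (rows A12/A34; junction (J-arch) at the CM PIN),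
seat prover-pub-hodgecm-mc-binder-2-g6-0 (gen 6), 2026-08-19.  Target in PKG: `HodgeCM/Model/HypCensus/ArchDatumCM.lean`
(NEW additive leaf; RUN 36+, after K-1).  KERNEL only: 0 records / named facts, 0 proof holes.
-/
import Summits.HodgeConjecture.HodgeCM.Model.HypCensus.ArchDatum
import Literature.NumberTheory.GelbartRogawski1991.UnitaryDualPairThetaKernelCM

/-!
# Census kit (rows A12/A34), (J-arch) at the CM pin: the archimedean Weil representation of `ω_ψ ∘ cmPairSplitting hGR`

Specialisation of `ArchFactor` / `ArchDatum` (generic GR91 dual pair) to the data of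
`GelbartRogawski1991/UnitaryDualPairThetaKernelCM` (`F = L⁺`, `E = L` CM, `c` = complex conjugation, `δ = imagUnit L`,
`J_V = diag dV`, `J_W = diag dW`, `T_• = realDiagonal`, the chosen compatible splitting `splittingOf … hGR` behind
`cmPairSplitting … hGR`), for any ranks `N, M` and enumeration `e : Fin N × Fin M ≃ Fin n` (the cell's pin: `N = 3`,
`M = 2`, `e = finProdFinEquiv`):

* `cmArchWeilRep L e dV … hGR : Representation ℂ (U(diag dV)(L ⊗ ℝ) × U(diag dW)(L ⊗ ℝ)) 𝓢((Fin n → L⁺ ⊗ ℝ), ℂ)`;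
* **`omega_cmPairSplitting_arch_map_tmul`** — `ω_ψ(cmPairSplitting hGR (x_∞, y_∞)) (E(Φ_∞ ⊗ Φ_f)) = E(cmArchWeilRep (x,y) Φ_∞ ⊗ Φ_f)`:
  the archimedean pair elements of the v2 pin `W := wmInputCM₂b …` act on pure tensors through `cmArchWeilRep ⊗ 1`
  (`W.ρ = (cmPairRepTwist … η).toHomUnits = η • (ω_ψ ∘ cmPairSplitting)`, so together with `ArchValues` this is the
  `K_∞ × T_∞` action the census fields `ins`/`omg_ins`/`smooth` read);
* `cmArchWeilRep_rhoSD` — its exact Heisenberg covariance (Folland form) in any real frame.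

Inputs: `ArchFactor`/`ArchDatum` (this lane) + `proj` compatibility `splittingOf_isCompatible` and the `rfl`
`cmPairSplitting = pairSplitting … (splittingOf … hGR)` (tree).  Nothing here is a claim of PerL/QW8.
-/

set_option autoImplicit false

noncomputable section

open NumberField IsDedekindDomain
open scoped Matrix TensorProduct Classical
open Literature.NumberTheory.Automorphic Literature.NumberTheory.Weil1964
open Literature.NumberTheory.GelbartRogawski1991 Literature.NumberTheory.GelbartRogawski1991.UnitaryDualPair
open Literature.Analysis.SegalBargmann (rhoSD)

namespace HodgeCM.Model.HypCensus

section CMPin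

variable (L : Type) [Field L] [NumberField L] [IsCMField L] {N M n : ℕ} (e : Fin N × Fin M ≃ Fin n)
variable (dV : Fin N → L) (hdV : ∀ i, IsCMField.complexConj L (dV i) = dV i) (hdV0 : ∀ i, dV i ≠ 0)
variable (dW : Fin M → L) (hdW : ∀ i, IsCMField.complexConj L (dW i) = dW i) (hdW0 : ∀ i, dW i ≠ 0)
variable (hGR : (cmSplittingDatum L e dV hdV hdV0 dW hdW hdW0).CompatibleSplitting)

/-- the compatible splitting of record `s : G₁(𝔸_{L⁺}) →* Mp_ψ(𝕎_𝔸)ᶜᵒⁿᵗ` behind `cmPairSplitting … hGR` (its `Classical.choose`). -/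
def cmSplittingOf :
    UnitaryGroup.adelicPair (↥(maximalRealSubfield L)) L (IsCMField.complexConj L) N M (Matrix.diagonal dV)
        (Matrix.diagonal dW) →*
      adelicMpCont (↥(maximalRealSubfield L)) (Fin n)
        (adelicGram (↥(maximalRealSubfield L)) e (realDiagonal L dV hdV) (realDiagonal L dW hdW)) :=
  splittingOf (↥(maximalRealSubfield L)) L (IsCMField.complexConj L) N M e (Matrix.diagonal dV)
      (Matrix.diagonal dW) (complexConj_imagUnit L) (imagUnit_ne_zero L) (imagUnit_mul_self L)
      (realDiagonal_isSymm L dV hdV) (realDiagonal_isSymm L dW hdW)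
      (isUnit_det_realDiagonal L dV hdV hdV0) (isUnit_det_realDiagonal L dW hdW hdW0)
      (realDiagonal_map L dV hdV).symm (realDiagonal_map L dW hdW).symm hGR

/-- `cmSplittingOf` lies over `toSp` (GR91 compatibility, first clause). -/
theorem proj_cmSplittingOf (g : UnitaryGroup.adelicPair (↥(maximalRealSubfield L)) L (IsCMField.complexConj L) N M
    (Matrix.diagonal dV) (Matrix.diagonal dW)) :
    adelicMpCont.proj (↥(maximalRealSubfield L)) (Fin n)
        (adelicGram (↥(maximalRealSubfield L)) e (realDiagonal L dV hdV) (realDiagonal L dW hdW))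
        (cmSplittingOf L e dV hdV hdV0 dW hdW hdW0 hGR g) =
      toSp (↥(maximalRealSubfield L)) L (IsCMField.complexConj L) N M e (Matrix.diagonal dV) (Matrix.diagonal dW)
        (complexConj_imagUnit L) (imagUnit_ne_zero L) (imagUnit_mul_self L)
        (realDiagonal_isSymm L dV hdV) (realDiagonal_isSymm L dW hdW)
        (realDiagonal_map L dV hdV).symm (realDiagonal_map L dW hdW).symm g :=
  (splittingOf_isCompatible (↥(maximalRealSubfield L)) L (IsCMField.complexConj L) N M e (Matrix.diagonal dV)
      (Matrix.diagonal dW) (complexConj_imagUnit L) (imagUnit_ne_zero L) (imagUnit_mul_self L)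
      (realDiagonal_isSymm L dV hdV) (realDiagonal_isSymm L dW hdW)
      (isUnit_det_realDiagonal L dV hdV hdV0) (isUnit_det_realDiagonal L dW hdW hdW0)
      (realDiagonal_map L dV hdV).symm (realDiagonal_map L dW hdW).symm hGR).1 g

/-- `cmPairSplitting hGR = pairSplitting (cmSplittingOf hGR)` (definitional). -/
theorem cmPairSplitting_eq_pairSplitting :
    cmPairSplitting L e dV hdV hdV0 dW hdW hdW0 hGR =
      pairSplitting (↥(maximalRealSubfield L)) L (IsCMField.complexConj L) N M e (Matrix.diagonal dV) (Matrix.diagonal dW)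
        (cmSplittingOf L e dV hdV hdV0 dW hdW hdW0 hGR) := rfl

/-- **The archimedean Weil representation of the CM pin** `ω_ψ ∘ cmPairSplitting hGR`, as a representation of
`U(diag dV)(L ⊗ ℝ) × U(diag dW)(L ⊗ ℝ)` on `𝓢((Fin n → L⁺ ⊗ ℝ), ℂ)` (an `abbrev` of `archWeilRep` at the CM data,
so that every generic lemma of `ArchFactor`/`ArchDatum` applies by unification). -/
abbrev cmArchWeilRep :
    Representation ℂ
      (UnitaryGroup.arch (↥(maximalRealSubfield L)) L (IsCMField.complexConj L) N (Matrix.diagonal dV) ×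
        UnitaryGroup.arch (↥(maximalRealSubfield L)) L (IsCMField.complexConj L) M (Matrix.diagonal dW))
      (SchwartzMap (Fin n → mixedEmbedding.mixedSpace (↥(maximalRealSubfield L))) ℂ) :=
  archWeilRep (↥(maximalRealSubfield L)) L (IsCMField.complexConj L) N M (Matrix.diagonal dV) (Matrix.diagonal dW)
    (complexConj_imagUnit L) (imagUnit_ne_zero L) (imagUnit_mul_self L)
    (realDiagonal_isSymm L dV hdV) (realDiagonal_isSymm L dW hdW)
    (isUnit_det_realDiagonal L dV hdV hdV0) (isUnit_det_realDiagonal L dW hdW hdW0)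
    (realDiagonal_map L dV hdV).symm (realDiagonal_map L dW hdW).symm e
    (cmSplittingOf L e dV hdV hdV0 dW hdW hdW0 hGR) (proj_cmSplittingOf L e dV hdV hdV0 dW hdW hdW0 hGR)

/-- `cmPairSplitting hGR (x_∞, y_∞) = pairSplitting (cmSplittingOf hGR) (archProdHom (x, y))` (definitional). -/
theorem cmPairSplitting_archToAdelic
    (x : UnitaryGroup.arch (↥(maximalRealSubfield L)) L (IsCMField.complexConj L) N (Matrix.diagonal dV))
    (y : UnitaryGroup.arch (↥(maximalRealSubfield L)) L (IsCMField.complexConj L) M (Matrix.diagonal dW)) :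
    cmPairSplitting L e dV hdV hdV0 dW hdW hdW0 hGR
        (UnitaryGroup.archToAdelic (↥(maximalRealSubfield L)) L (IsCMField.complexConj L) N (Matrix.diagonal dV) x,
          UnitaryGroup.archToAdelic (↥(maximalRealSubfield L)) L (IsCMField.complexConj L) M (Matrix.diagonal dW) y) =
      pairSplitting (↥(maximalRealSubfield L)) L (IsCMField.complexConj L) N M e (Matrix.diagonal dV) (Matrix.diagonal dW)
        (cmSplittingOf L e dV hdV hdV0 dW hdW hdW0 hGR)
        (archProdHom (↥(maximalRealSubfield L)) L (IsCMField.complexConj L) N M (Matrix.diagonal dV)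
          (Matrix.diagonal dW) (x, y)) :=
  rfl

/-- **`ω_ψ(cmPairSplitting hGR (x_∞, y_∞)) (E(Φ_∞ ⊗ Φ_f)) = E(cmArchWeilRep (x,y) Φ_∞ ⊗ Φ_f)`** — the archimedean pair
elements of the CM pin act on pure tensors through `cmArchWeilRep ⊗ 1`. -/
theorem omega_cmPairSplitting_arch_map_tmul
    (x : UnitaryGroup.arch (↥(maximalRealSubfield L)) L (IsCMField.complexConj L) N (Matrix.diagonal dV))
    (y : UnitaryGroup.arch (↥(maximalRealSubfield L)) L (IsCMField.complexConj L) M (Matrix.diagonal dW))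
    (Φinf : SchwartzMap (Fin n → mixedEmbedding.mixedSpace (↥(maximalRealSubfield L))) ℂ)
    (f : FinSB (↥(maximalRealSubfield L)) (Fin n)) :
    adelicMpCont.omega (↥(maximalRealSubfield L)) (Fin n)
        (adelicGram (↥(maximalRealSubfield L)) e (realDiagonal L dV hdV) (realDiagonal L dW hdW))
        (cmPairSplitting L e dV hdV hdV0 dW hdW hdW0 hGR
          (UnitaryGroup.archToAdelic (↥(maximalRealSubfield L)) L (IsCMField.complexConj L) N (Matrix.diagonal dV) x,
            UnitaryGroup.archToAdelic (↥(maximalRealSubfield L)) L (IsCMField.complexConj L) M (Matrix.diagonal dW) y))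
        (piSchwartzBruhatEquiv (↥(maximalRealSubfield L)) (Fin n) (Φinf ⊗ₜ[ℂ] f)) =
      piSchwartzBruhatEquiv (↥(maximalRealSubfield L)) (Fin n)
        (cmArchWeilRep L e dV hdV hdV0 dW hdW hdW0 hGR (x, y) Φinf ⊗ₜ[ℂ] f) := by
  -- `cmPairSplitting hGR (x̃, ỹ)` is `pairSplitting (cmSplittingOf hGR) (archProdHom (x, y))` definitionally
  exact omega_pairSplitting_arch_map_tmul (↥(maximalRealSubfield L)) L (IsCMField.complexConj L) N M (Matrix.diagonal dV)
    (Matrix.diagonal dW) (complexConj_imagUnit L) (imagUnit_ne_zero L) (imagUnit_mul_self L)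
    (realDiagonal_isSymm L dV hdV) (realDiagonal_isSymm L dW hdW)
    (isUnit_det_realDiagonal L dV hdV hdV0) (isUnit_det_realDiagonal L dW hdW hdW0)
    (realDiagonal_map L dV hdV).symm (realDiagonal_map L dW hdW).symm e
    (cmSplittingOf L e dV hdV hdV0 dW hdW hdW0 hGR) (proj_cmSplittingOf L e dV hdV hdV0 dW hdW hdW0 hGR) (x, y) Φinf f

/-- each `cmArchWeilRep … u` is continuous on `𝓢`. -/
theorem continuous_cmArchWeilRep
    (u : UnitaryGroup.arch (↥(maximalRealSubfield L)) L (IsCMField.complexConj L) N (Matrix.diagonal dV) ×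
      UnitaryGroup.arch (↥(maximalRealSubfield L)) L (IsCMField.complexConj L) M (Matrix.diagonal dW)) :
    Continuous (cmArchWeilRep L e dV hdV hdV0 dW hdW hdW0 hGR u) :=
  continuous_archWeilRep (↥(maximalRealSubfield L)) L (IsCMField.complexConj L) N M (Matrix.diagonal dV)
    (Matrix.diagonal dW) (complexConj_imagUnit L) (imagUnit_ne_zero L) (imagUnit_mul_self L)
    (realDiagonal_isSymm L dV hdV) (realDiagonal_isSymm L dW hdW)
    (isUnit_det_realDiagonal L dV hdV hdV0) (isUnit_det_realDiagonal L dW hdW hdW0)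
    (realDiagonal_map L dV hdV).symm (realDiagonal_map L dW hdW).symm e
    (cmSplittingOf L e dV hdV hdV0 dW hdW hdW0 hGR) (proj_cmSplittingOf L e dV hdV hdV0 dW hdW hdW0 hGR) u

end CMPin

end HodgeCM.Model.HypCensus

end
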